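import Literature.IUT.HodgeTheaters.TemperedCoveringsCor23viSurfaceTypeBranchGluing
import Literature.IUT.HodgeTheaters.TemperedCoveringsCor23viHatIncidenceOfSeparatingQuotient
import Literature.AnabelianGeometry.SemiGraphs.TemperedSeparatingQuotientOfCovering
import HarnessLib

/-!
# [IUTchI] Cor. 2.3 (vi): the pro-`Σ̂` incidence `hF` at a cusp of a vertex carrying a SECOND CUSP of a semi-graph of
# anabelioids of SURFACE TYPE — a THEOREM by the one-level criterion (a `ℤ/ℓ`-translation covering)

S. Mochizuki, *Inter-universal Teichmüller theory I*, kurims manuscript (May 2020), §2, Cor. 2.3 (vi) p. 48 l. 6–16, proof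
p. 49 l. 62–64 [cite: Mochizuki2012, Cor 2.3(vi) pp.48-49] (D-0012 claim key; series DISPUTED; nothing of it is asserted
here); S. Mochizuki, *Semi-graphs of anabelioids*, Publ. RIMS **42** (2006), Example 2.10 p. 31, §3 Def. 3.5 (i)/(ii) p. 37,
Prop. 3.6 (iii) p. 38, Thm. 3.7 (i)/(iii) pp. 40–41 [cite: MochizukiSemiAnbd2006, Ex. 2.10 p.31].

PROOF-ONLY file (abc-iut cell, seat abc-iut-L5-d5 gen 10, self-named count-neutral in-lineage row
«COR23VI-HF-TWO-LEVEL@CAVEAT», complement to `TemperedCoveringsCor23viHatCuspIncidenceDoublyBound.lean`; cone row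
`IUTchI:Cor2.3(vi)`, GAP-LEDGER G-w4d059-g8-1; no definition, no instance, no notation, no `Prop` fact).  Consumed BY NAME:
`TranslationCover.exists_cover`, `SurfaceTypeCharacters.exists_character_cusp_eq`, `DoublyBoundCusp.branch_values`,
abc-iut-L3-t11's `exists_openNormal_separating_decomp_singleVertex_of_covering` (p502554), abc-iut-w4-d070's
`not_map_le_conj_closure_of_openNormal` (p498282), abc-iut-L3-t2's `FiniteIsTempered_holds`.

**`TwoCusps.not_map_le_conj_closure_of_twoCusps`** — for `𝒢 : ProfiniteSemiGraph` with the hypotheses of [SemiAnbd]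
Prop. 3.6, a vertex `u` carrying the surface-type datum of Example 2.10 (`ι : Γ_{g,r} → Π_u` pro-`Σ` completion,
injective cusp assignment, branch groups the conjugated closed cusp inertia groups) — NO datum is needed elsewhere —, a
prime `ℓ ∈ Σ`, a vertex `w ≠ u`, and two DISTINCT cusps `e, e₂` at `u`: for every chart, completion, `Π^tp_ℍ := TpH ∈
decompSubgroups c ⟨{w}, ∅⟩`, edge-like `L` at `e` and `g`:  `ι(L) ⊄ g · closure ι(TpH) · g⁻¹`.  The `ℤ/ℓ`-translation
covering with `c_{js e} ↦ 1`, `c_{js e₂} ↦ −1` at `u` and trivial characters elsewhere (all gluings identities: no other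
branch carries a non-trivial character) is split over `w` and moved by `Π_e`, so p498282's one-level criterion applies.
Together with the doubly-bound theorem: `hF`'s premise fails at every cusp of a vertex `u ≠ w` that carries a second cusp
OR two edges to `w` — the remaining single-vertex-`ℍ` cusp configurations (genus-`0` `u`, one cusp, `≤ 1` edge to `w`)
need a compensation away from `u` (GAP-LEDGER D-G-w4d059-g8-1 route (C3)).

BINDER CENSUS: LAW 0 · FACT 0 · ORIGIN 1 (the surface-type datum at `u`, ORIGIN only at the genuine `S.Gc`).  HONEST
LIMITS as in the doubly-bound file (single-vertex `ℍ`; non-vacuity of the joint hypothesis class not assembled here).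
Nothing here bears on [IUTchIII] Cor. 3.12; typed ≠ inhabited ≠ discharged; nothing asserts that abc is proved or refuted.
-/

noncomputable section

namespace Literature.IUT.HodgeTheaters

open _root_.Topology CategoryTheory
open scoped Pointwise
open Literature.AnabelianGeometry.SemiGraphs
open Literature.AnabelianGeometry.SemiGraphs.ProfiniteSemiGraph
open Literature.AnabelianGeometry.SemiGraphs.SemiGraphOfAnabelioids (IsProSigmaCompletion)
open Literature.GroupTheory.CombinatorialGroupTheory
open Literature.GroupTheory.CombinatorialGroupTheory.PuncturedSurfaceGroup
open Multiplicative SurfaceTypeCharacters TranslationCover DoublyBoundCusp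

namespace TwoCusps

variable {𝒢 : ProfiniteSemiGraph.{0}} {ℓ : ℕ} [hℓ : Fact ℓ.Prime]

/-- **[IUTchI] Cor. 2.3 (vi): the premise of the pro-`Σ̂` incidence `hF` FAILS at every cusp of a vertex carrying a SECOND
cusp**, for every semi-graph of profinite groups with the hypotheses of [SemiAnbd] Prop. 3.6 whose vertex `u` carries the
surface-type datum of Example 2.10 (`ι : Γ_{g,r} → Π_u` a pro-`Σ` completion, an injective cusp assignment `js`, branch
groups the conjugated closed cusp inertia groups).  For a prime `ℓ ∈ Σ`, a vertex `w ≠ u`, two distinct cusps `e = edgeOf be`,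
`e₂ = edgeOf be₂` at `u` (their other branches abut no vertex): for every chart `c`, every profinite completion `ι`, every
`TpH ∈ decompSubgroups c ⟨{w}, ∅⟩`, every edge-like `L` at `e` and every `g`, `ι(L) ⊄ g · closure ι(TpH) · g⁻¹`.  Here the
ONE-LEVEL criterion of p498282 suffices: the `ℤ/ℓ`-translation covering with `c_{js be} ↦ 1`, `c_{js be₂} ↦ −1`, trivial
elsewhere, is split over `w` and moved by `Π_e`. [cite: Mochizuki2012, Cor 2.3(vi) pp.48-49]
[cite: MochizukiSemiAnbd2006, Ex. 2.10 p.31] [claim: Mochizuki2012, status: disputed] -/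
theorem not_map_le_conj_closure_of_twoCusps (h36 : 𝒢.Prop36Hypotheses) {Sigma : Set ℕ} (hℓS : ℓ ∈ Sigma)
    {u w : 𝒢.graph.Vertex} (huw : u ≠ w)
    (hu : ∃ (g r : ℕ) (ι : PuncturedSurfaceGroup g r →* 𝒢.Gv u),
      IsHyperbolicType g r ∧ IsProSigmaCompletion Sigma ι ∧
        ∃ js : 𝒢.graph.Star u → Fin r, Function.Injective js ∧
          ∀ b : 𝒢.graph.Star u, ∃ x : 𝒢.Gv u, 𝒢.branchSubgroup b.1 u b.2 =
            ConjAct.toConjAct x • ((cuspInertia (g := g) (js b)).map ι).topologicalClosure)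
    (be be₂ : 𝒢.graph.Star u) (hne : be ≠ be₂)
    (hopen : ∀ b' : 𝒢.graph.Branch, 𝒢.graph.edgeOf b' = 𝒢.graph.edgeOf be.1 → b' ≠ be.1 → 𝒢.graph.abuts b' = none)
    (hopen₂ : ∀ b' : 𝒢.graph.Branch, 𝒢.graph.edgeOf b' = 𝒢.graph.edgeOf be₂.1 → b' ≠ be₂.1 →
      𝒢.graph.abuts b' = none)
    (c : TemperedPiChart 𝒢) {Ghat : Type*} [Group Ghat] [TopologicalSpace Ghat] [IsTopologicalGroup Ghat]
    {ι : c.G →ₜ* Ghat} (hι : IsProfiniteCompletion ι) {TpH : Subgroup c.G}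
    (hTpH : TpH ∈ c.decompSubgroups ⟨{w}, ∅⟩) {L : Subgroup c.G}
    (hL : L ∈ edgeLikeSubgroups c (𝒢.graph.edgeOf be.1)) (g : Ghat) :
    ¬ L.map ι.toMonoidHom ≤ MulAut.conj g • (TpH.map ι.toMonoidHom).topologicalClosure := by
  classical
  haveI : Fact ℓ.Prime := hℓ
  /- 1. the character at `u` -/
  obtain ⟨gu, ru, ιu, -, hιu, jsu, hjsu, hbru⟩ := hu
  let du : Fin ru → ZMod ℓ := Pi.single (jsu be) 1 + Pi.single (jsu be₂) (-1)
  have hdu_sum : ∑ j, du j = 0 := by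
    simp only [du, Pi.add_apply, Finset.sum_add_distrib, Finset.sum_pi_single', Finset.mem_univ, if_true,
      add_neg_cancel]
  have hdue : du (jsu be) = 1 := by
    simp only [du, Pi.add_apply, Pi.single_eq_same, Pi.single_eq_of_ne (hjsu.ne hne), add_zero]
  have hdu0 : ∀ b : 𝒢.graph.Star u, b ≠ be → b ≠ be₂ → du (jsu b) = 0 := fun b h1 h2 => by
    simp only [du, Pi.add_apply, Pi.single_eq_of_ne (hjsu.ne h1), Pi.single_eq_of_ne (hjsu.ne h2), add_zero]
  have hcardu : Nat.card (ZMod ℓ) = ℓ ^ 1 := by rw [Nat.card_zmod, pow_one]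
  obtain ⟨χu, hχuo, hχu⟩ := exists_character_cusp_eq (g := gu) hιu hℓ.out hℓS hcardu du hdu_sum
  let χu' : 𝒢.Gv u →ₜ* Multiplicative (ZMod ℓ) := ⟨χu, continuous_of_isOpen_ker χu hχuo⟩
  let χ : ∀ v : 𝒢.graph.Vertex, 𝒢.Gv v →ₜ* Multiplicative (ZMod ℓ) := fun v =>
    if h : v = u then h ▸ χu' else 1
  have hχu' : χ u = χu' := by
    change (if h : u = u then h ▸ χu' else 1) = χu'
    rw [dif_pos rfl]
  have hχo : ∀ v, v ≠ u → χ v = 1 := fun v h => by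
    change (if h : v = u then h ▸ χu' else 1) = 1
    rw [dif_neg h]
  have hVu := branch_values h36.isOfInjectiveType ιu jsu hbru χu' du hχu
  /- 2. every glued pair of branches carries trivial characters (the two cusps have no second abutting branch) -/
  have hT : ∀ (b : 𝒢.graph.Branch) (v : 𝒢.graph.Vertex) (hb : 𝒢.graph.abuts b = some v),
      b ≠ be.1 → b ≠ be₂.1 → ∀ t, χ v (𝒢.brHom b v hb t) = 1 := by
    intro b v hb n1 n2 t
    by_cases hvu : v = u
    · subst hvu
      have h0 := hdu0 ⟨b, hb⟩ (fun h => n1 (congrArg Subtype.val h)) (fun h => n2 (congrArg Subtype.val h))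
      have h := (hVu ⟨b, hb⟩).1 t
      rw [h0, AddSubgroup.zmultiples_zero_eq_bot, AddSubgroup.mem_bot] at h
      rw [hχu', ← ofAdd_toAdd (χu' _), h, ofAdd_zero]
    · rw [hχo v hvu]
      rfl
  have hglue : ∀ (b : 𝒢.graph.Branch) (v : 𝒢.graph.Vertex) (hb : 𝒢.graph.abuts b = some v)
      (b' : 𝒢.graph.Branch) (v' : 𝒢.graph.Vertex) (hb' : 𝒢.graph.abuts b' = some v')
      (he : 𝒢.graph.edgeOf b' = 𝒢.graph.edgeOf b), b' ≠ b →
      ∃ A : Multiplicative (ZMod ℓ) ≃ Multiplicative (ZMod ℓ),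
        ∀ (t : 𝒢.Ge (𝒢.graph.edgeOf b)) (m : Multiplicative (ZMod ℓ)),
          A ((he ▸ (χ v').comp (𝒢.brHom b' v' hb') : 𝒢.Ge (𝒢.graph.edgeOf b) →ₜ* _) t * m) =
            χ v (𝒢.brHom b v hb t) * A m := by
    intro b v hb b' v' hb' he hbb
    -- neither `b` nor `b'` is a branch of one of the two cusps
    have hb1 : b ≠ be.1 := fun h => by
      subst h; exact absurd (hopen b' he hbb) (by rw [hb']; exact Option.some_ne_none v')
    have hb2 : b ≠ be₂.1 := fun h => by
      subst h; exact absurd (hopen₂ b' he hbb) (by rw [hb']; exact Option.some_ne_none v')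
    have hb1' : b' ≠ be.1 := fun h => by
      subst h; exact absurd (hopen b he.symm (Ne.symm hbb)) (by rw [hb]; exact Option.some_ne_none v)
    have hb2' : b' ≠ be₂.1 := fun h => by
      subst h; exact absurd (hopen₂ b he.symm (Ne.symm hbb)) (by rw [hb]; exact Option.some_ne_none v)
    refine ⟨Equiv.refl _, fun t m => ?_⟩
    rw [Equiv.refl_apply, Equiv.refl_apply, hT b v hb hb1 hb2 t,
      forall_transport χ hb' he (P := fun m => m = 1) (hT b' v' hb' hb1' hb2') t]
  /- 3. the covering, split over `w`, moved by `Π_e` -/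
  obtain ⟨S, hfin, hV, hE⟩ := exists_cover χ hglue
  have hfix : ∀ (γ : 𝒢.Gv w) (s : (S.SV w).obj.V), (S.SV w).obj.ρ γ s = s := fun γ =>
    (hV w γ).mpr (by rw [hχo w (Ne.symm huw)]; rfl)
  have hmove : ∃ (γ : 𝒢.Ge (𝒢.graph.edgeOf be.1)) (s : (S.SE (𝒢.graph.edgeOf be.1)).obj.V),
      (S.SE (𝒢.graph.edgeOf be.1)).obj.ρ γ s ≠ s := by
    obtain ⟨t₀, ht₀⟩ := (hVu be).2.1
    rw [hdue] at ht₀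
    by_contra hcon
    have hall : ∀ s, (S.SE (𝒢.graph.edgeOf be.1)).obj.ρ t₀ s = s := fun s =>
      not_not.mp fun hs => hcon ⟨t₀, s, hs⟩
    have h := (hE be.1 u be.2 t₀).mp hall
    rw [hχu', ht₀, ofAdd_eq_one] at h
    exact one_ne_zero h
  let T : BTempCat 𝒢 := ⟨S, FiniteIsTempered_holds 𝒢 h36.isConnected h36.isCountable S hfin⟩
  haveI : Finite (T.obj.SV w).obj.V := hfin.finite_V w
  obtain ⟨U, hU, hTU, hLU⟩ := TemperedPiChart.exists_openNormal_separating_decomp_singleVertex_of_covering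
    h36.isQuasiCoherent h36.isGaloisCountable c T hfix hmove hTpH
  exact StableCurveTemperedData.not_map_le_conj_closure_of_openNormal c hι U hU hTU (hLU L hL) g

end TwoCusps

end Literature.IUT.HodgeTheaters
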